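import Literature.InformationTheory.Entanglement.MerminKlyshkoGHZ
import Mathlib.Algebra.Order.Chebyshev
import HarnessLib

/-!
# The spin-squeezing entanglement criterion `(ΔJ_z)²/(⟨J_x⟩² + ⟨J_y⟩²) ≥ 1/N` on separable states

Topic `Literature/InformationTheory/Entanglement`, on the register `Fin N → Bool` with the Pauli
strings `pauliWord` of `MerminKlyshkoGHZ.lean` and the vector / trace states of
`TsirelsonBound.lean`.  Source (held text, read at the cited place):

* O. Gühne, G. Tóth, *Entanglement detection*, Phys. Rep. 474, 1 (2009) = arXiv:0811.2803
  [GuhneToth2009], §8.1 (“`J_l := Σ_{k=1}^N ½σ_l^{(k)}` … the variances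
  `(ΔJ_k)² = ⟨J_k²⟩ − ⟨J_k⟩²`”) and §8.1.1 eq. (194): “spin squeezing can be shown to be connected
  to entanglement: If an `N`-qubit state violates the inequality [499]
  **`(ΔJ_z)²/(⟨J_x⟩² + ⟨J_y⟩²) ≥ 1/N`** (194), then the state is entangled, i.e., not fully
  separable … A typical spin squeezing experiment starts with a fully polarized sample
  `|Ψ⟩_init := |½⟩_x^{⊗N}`. Such a state saturates Eq. (194) … For an ensemble strongly polarized
  into the `x` direction one has `⟨J_x⟩ ≈ N/2` and `⟨J_y⟩ ≈ 0`”; [499] = A. Sørensen, L.-M. Duan,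
  J. I. Cirac, P. Zoller, Nature 409, 63 (2001) (cited through the review); §8.1.2 eq. (195):
  “For separable states `(ΔJ_x)² + (ΔJ_y)² + (ΔJ_z)² ≥ N/2` holds … Interestingly, all pure
  product states saturate the inequality”; §8.1.3 eq. (197): “For separable states
  `⟨J_x²⟩ + ⟨J_y²⟩ ≤ (N/2)(N/2 + ½)` holds. This inequality detects entanglement close to the
  `N`-qubit Dicke state” (ref. [213] of the review).

HONEST FRAMING (pub-qadeq lane — ‘entanglement of 10ⁿ atoms’ / ‘metrologically useful squeezing’
claims certified by a squeezing parameter `ξ² < 1`): instance-level adjudication of specific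
advantage claims; no claim about BQP vs BPP or the summit.  This file proves the criterion for
qubit registers; collective-spin estimation statistics, particle-number fluctuations and bosonic
symmetry are not addressed.

## Contents (all proved, 0 named facts)

* `productVec φ = ⊗_i φ_i` and the two tensor rules **`pauliWord_mulVec_productVec`**
  (`(⊗σ_{w_i})(⊗φ_i) = ⊗(σ_{w_i}φ_i)`) and **`star_productVec_dotProduct`**
  (`⟨⊗φ_i, ⊗χ_i⟩ = Π_i ⟨φ_i, χ_i⟩`); `localPauli l i = σ_l^{(i)}`, `collectiveSpin l = ½Σ_i σ_l^{(i)}`.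
* Single-qubit Bloch components `bloch l φ = ⟨φ|σ_l|φ⟩` with **`bloch_sq_sum`**
  (`x² + y² + z² = 1` for a unit qubit vector).
* Pure product states: `expect_collectiveSpin_productVec` (`⟨J_l⟩ = ½Σ_i l_i`),
  **`variance_collectiveSpin_productVec`** (`(ΔJ_l)² = ¼Σ_i(1 − l_i²)` — “the variance of a
  collective observable is the sum of the single-particle variances”), hence
  **`spinSqueezing_productVec`**: `N(ΔJ_z)² ≥ ⟨J_x⟩² + ⟨J_y⟩²`.
* Mixed fully separable states `IsSeparable ρ` (convex combinations of pure product projectors):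
  concavity of the variance and convexity of `⟨J⟩²` give **`spinSqueezing_criterion`**:
  `N·(ΔJ_z)²_ρ ≥ ⟨J_x⟩_ρ² + ⟨J_y⟩_ρ²`, i.e. eq. (194) whenever the denominator is non-zero
  (`spinSqueezing_criterion_div`), and **`not_isSeparable_of_squeezing`** (violation ⟹ entangled).
* `saturation_polarized`: the fully polarized product state `|+⟩^{⊗N}` has `⟨J_x⟩ = N/2`,
  `⟨J_y⟩ = 0`, `(ΔJ_z)² = N/4` — “Such a state saturates Eq. (194)”.
* The singlet criterion, §8.1.2 eq. (195): `sum_variance_productVec` (“all pure product states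
  saturate”: `Σ_l (ΔJ_l)² = N/2`), `varianceT_mixture_ge` (concavity of the variance),
  **`singlet_criterion`** (`Σ_l (ΔJ_l)² ≥ N/2` on fully separable states),
  `not_isSeparable_of_singlet_violation`.
* The Dicke-state criterion, §8.1.3 eq. (197): `dicke_criterion_productVec`,
  **`dicke_criterion`** (`⟨J_x²⟩ + ⟨J_y²⟩ ≤ (N/2)(N/2 + ½)` on fully separable states; planar
  Cauchy–Schwarz `Σ_{i≠j}(x_ix_j + y_iy_j) ≤ N(N−1)` and linearity in `ϱ`),
  `not_isSeparable_of_dicke_violation`.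
* Link to `GHZFidelityWitness.lean`: `productVec_eq_tensorAcross` (a product vector is a tensor
  product across every cut), `IsProductPure.isBiseparablePure`, **`IsSeparable.isBiseparable`**
  (`N ≥ 2`: fully separable ⟹ biseparable, so the GME criteria of the sibling files also exclude
  full separability).

NOT formalised: the converse directions, `k`-particle entanglement bounds [500], symmetric-state
refinements [501], bosonic / fluctuating-`N` ensembles.

## Mathlib / tree search

`CollectiveSpinVarianceBound.lean` treats `Z`-diagonal (commuting) collective quantities via
classical Born weights; the present criterion needs non-commuting `J_x, J_y, J_z` in one state,
hence the register formalism.  Reused: `pauliWord`, `pauliWord_apply`, `pauliWord_isHermitian`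
(`MerminKlyshkoGHZ.lean`), `vecState`, `trState` (`TsirelsonBound.lean`), `Pauli.mat`.
-/

noncomputable section

open scoped BigOperators ComplexOrder
open Matrix Complex Finset
open Literature.Computability.QuantumComplexity
open Literature.InformationTheory.Entanglement.Tsirelson

namespace Literature.InformationTheory.Entanglement

namespace SpinSqueezing

open MerminKlyshkoGHZ

variable {N : ℕ}

/-! ## Product vectors and the two tensor rules -/

/-- The product vector `⊗_{i=1}^N φ_i`: amplitude `Π_i φ_i(x_i)` on the basis label `x`.
[cite: GuhneToth2009, §8.1.1 (“fully polarized sample `|½⟩_x^{⊗N}`”; fully separable states)] -/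
def productVec (φ : Fin N → Bool → ℂ) : (Fin N → Bool) → ℂ := fun x => ∏ i, φ i (x i)

/-- Unfolding `productVec`. [cite: GuhneToth2009, §8.1.1] -/
theorem productVec_apply (φ : Fin N → Bool → ℂ) (x : Fin N → Bool) :
    productVec φ x = ∏ i, φ i (x i) := rfl

/-- **Tensor rule 1**: a Pauli string acts factorwise on a product vector,
`(⊗_i σ_{w_i})(⊗_i φ_i) = ⊗_i (σ_{w_i} φ_i)`. [cite: GuhneToth2009, §8.1 (local operators
`σ_l^{(k)}`)] -/
theorem pauliWord_mulVec_productVec (w : Fin N → Pauli) (φ : Fin N → Bool → ℂ) :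
    pauliWord w *ᵥ productVec φ = productVec fun i => (w i).mat *ᵥ φ i := by
  funext y
  rw [Matrix.mulVec, dotProduct, productVec_apply]
  simp only [pauliWord_apply, productVec_apply, Matrix.mulVec, dotProduct]
  rw [Fintype.prod_sum]
  refine Finset.sum_congr rfl fun x _ => ?_
  rw [← Finset.prod_mul_distrib]

/-- **Tensor rule 2**: inner products of product vectors factorise,
`⟨⊗φ_i, ⊗χ_i⟩ = Π_i ⟨φ_i, χ_i⟩`. [cite: GuhneToth2009, §8.1] -/
theorem star_productVec_dotProduct (φ χ : Fin N → Bool → ℂ) :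
    star (productVec φ) ⬝ᵥ productVec χ = ∏ i, (star (φ i) ⬝ᵥ χ i) := by
  simp only [dotProduct, Pi.star_apply, productVec_apply, star_prod]
  rw [Fintype.prod_sum]
  refine Finset.sum_congr rfl fun x _ => ?_
  rw [← Finset.prod_mul_distrib]

/-! ## Local Paulis and collective spins -/

/-- The local Pauli `σ_l^{(i)} = 𝟙 ⊗ … ⊗ σ_l ⊗ … ⊗ 𝟙` (site `i`). [cite: GuhneToth2009, §8.1] -/
def localPauli (l : Pauli) (i : Fin N) : Matrix (Fin N → Bool) (Fin N → Bool) ℂ :=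
  pauliWord (Function.update (fun _ => Pauli.I) i l)

/-- The collective spin `J_l = Σ_{k=1}^N ½ σ_l^{(k)}`. [cite: GuhneToth2009, §8.1] -/
def collectiveSpin (l : Pauli) (N : ℕ) : Matrix (Fin N → Bool) (Fin N → Bool) ℂ :=
  ((1 : ℝ) / 2) • ∑ i : Fin N, localPauli l i

/-- `σ_l^{(i)}` on a product vector: only factor `i` changes. [cite: GuhneToth2009, §8.1] -/
theorem localPauli_mulVec_productVec (l : Pauli) (i : Fin N) (φ : Fin N → Bool → ℂ) :
    localPauli l i *ᵥ productVec φ = productVec (Function.update φ i (l.mat *ᵥ φ i)) := by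
  rw [localPauli, pauliWord_mulVec_productVec]
  congr 1
  funext j
  by_cases h : j = i
  · subst h; simp
  · rw [Function.update_of_ne h, Function.update_of_ne h, Pauli.mat]; simp

/-- The Bloch component `⟨φ|σ_l|φ⟩` of a qubit vector (real, `σ_l` being Hermitian).
[cite: GuhneToth2009, §8.1] -/
def bloch (l : Pauli) (φ : Bool → ℂ) : ℝ := (star φ ⬝ᵥ (l.mat *ᵥ φ)).re

/-- `⟨φ|σ_l|φ⟩` is real: it equals its real part. [cite: GuhneToth2009, §8.1] -/
theorem star_dotProduct_pauli_mulVec (l : Pauli) (φ : Bool → ℂ) :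
    star φ ⬝ᵥ (l.mat *ᵥ φ) = (bloch l φ : ℂ) := by
  have h : star (star φ ⬝ᵥ (l.mat *ᵥ φ)) = star φ ⬝ᵥ (l.mat *ᵥ φ) := by
    rw [← star_dotProduct, ← star_dotProduct_conjTranspose_mulVec, Pauli.conjTranspose_mat]
  have h' : (starRingEnd ℂ) (star φ ⬝ᵥ (l.mat *ᵥ φ)) = star φ ⬝ᵥ (l.mat *ᵥ φ) := by
    simpa [Complex.star_def] using h
  rw [bloch]
  exact ((Complex.conj_eq_iff_re).1 h').symm

/-- `⟨σ_l φ, φ⟩ = ⟨φ, σ_l φ⟩ = bloch` (Hermitian `σ_l`, real value). [cite: GuhneToth2009, §8.1] -/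
theorem star_pauli_mulVec_dotProduct (l : Pauli) (φ : Bool → ℂ) :
    star (l.mat *ᵥ φ) ⬝ᵥ φ = (bloch l φ : ℂ) := by
  rw [← star_dotProduct_conjTranspose_mulVec, Pauli.conjTranspose_mat, star_dotProduct_pauli_mulVec]

/-- `⟨σ_l φ, σ_l φ⟩ = ⟨φ, φ⟩` (`σ_l² = 𝟙`). [cite: GuhneToth2009, §8.1] -/
theorem star_pauli_mulVec_dotProduct_self (l : Pauli) (φ : Bool → ℂ) :
    star (l.mat *ᵥ φ) ⬝ᵥ (l.mat *ᵥ φ) = star φ ⬝ᵥ φ := by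
  rw [← star_dotProduct_conjTranspose_mulVec, Pauli.conjTranspose_mat, mulVec_mulVec,
    Pauli.mat_mul_self, one_mulVec]

section ProductState

variable (φ : Fin N → Bool → ℂ) (hφ : ∀ i, star (φ i) ⬝ᵥ φ i = 1)
include hφ

/-- **`⟨σ_l^{(i)}⟩ = ⟨φ_i|σ_l|φ_i⟩`** in the product state `⊗φ_j` (unit factors).
[cite: GuhneToth2009, §8.1] -/
theorem expect_localPauli (l : Pauli) (i : Fin N) :
    vecState (productVec φ) (localPauli l i) = bloch l (φ i) := by
  rw [vecState_apply, localPauli_mulVec_productVec, star_productVec_dotProduct,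
    Fintype.prod_eq_single i fun j hj => by rw [Function.update_of_ne hj, hφ j],
    Function.update_self, star_dotProduct_pauli_mulVec, Complex.ofReal_re]

/-- **`⟨J_l⟩ = ½ Σ_i ⟨φ_i|σ_l|φ_i⟩`** in a product state. [cite: GuhneToth2009, §8.1] -/
theorem expect_collectiveSpin (l : Pauli) :
    vecState (productVec φ) (collectiveSpin l N) = 1 / 2 * ∑ i, bloch l (φ i) := by
  rw [collectiveSpin, map_smul, map_sum, smul_eq_mul]
  congr 1
  exact Finset.sum_congr rfl fun i _ => expect_localPauli φ hφ l i

/-- The two-point function in a product state: `⟨σ_l^{(i)}σ_l^{(j)}⟩ = [i = j] + [i ≠ j] l_i l_j`.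
[cite: GuhneToth2009, §8.1] -/
theorem expect_localPauli_mul (l : Pauli) (i j : Fin N) :
    vecState (productVec φ) (localPauli l i * localPauli l j) =
      if i = j then 1 else bloch l (φ i) * bloch l (φ j) := by
  have hherm : (localPauli l i : Matrix (Fin N → Bool) (Fin N → Bool) ℂ)ᴴ = localPauli l i :=
    (pauliWord_isHermitian _).eq
  rw [vecState_apply, ← mulVec_mulVec, ← hherm, star_dotProduct_conjTranspose_mulVec,
    localPauli_mulVec_productVec, localPauli_mulVec_productVec, star_productVec_dotProduct]
  by_cases hij : i = j
  · subst hij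
    rw [if_pos rfl, Fintype.prod_eq_single i fun k hk => by
      rw [Function.update_of_ne hk, hφ k]]
    rw [Function.update_self, star_pauli_mulVec_dotProduct_self, hφ i, Complex.one_re]
  · rw [if_neg hij, Finset.prod_eq_mul i j hij (fun k _ hk => by
      rw [Function.update_of_ne hk.1, Function.update_of_ne hk.2, hφ k])
      (fun h => absurd (Finset.mem_univ _) h) (fun h => absurd (Finset.mem_univ _) h)]
    rw [Function.update_self, Function.update_of_ne hij, Function.update_of_ne (Ne.symm hij),
      Function.update_self, star_pauli_mulVec_dotProduct, star_dotProduct_pauli_mulVec,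
      ← Complex.ofReal_mul, Complex.ofReal_re]

/-- **`⟨J_l²⟩ = ¼(N + (Σ_i l_i)² − Σ_i l_i²)`** in a product state. [cite: GuhneToth2009, §8.1] -/
theorem expect_collectiveSpin_sq (l : Pauli) :
    vecState (productVec φ) (collectiveSpin l N * collectiveSpin l N) =
      1 / 4 * (N + (∑ i, bloch l (φ i)) ^ 2 - ∑ i, bloch l (φ i) ^ 2) := by
  rw [collectiveSpin, smul_mul_assoc, mul_smul_comm, smul_smul, map_smul, smul_eq_mul,
    Finset.sum_mul_sum, map_sum]
  simp_rw [map_sum, expect_localPauli_mul φ hφ l]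
  rw [show (1 / 2 * (1 / 2) : ℝ) = 1 / 4 by norm_num]
  congr 1
  -- `Σ_i Σ_j ([i=j] + [i≠j] b_i b_j) = N + (Σ b)² − Σ b²`
  have h : ∀ i : Fin N, ∑ j, (if i = j then (1 : ℝ) else bloch l (φ i) * bloch l (φ j)) =
      1 + (bloch l (φ i) * ∑ j, bloch l (φ j) - bloch l (φ i) ^ 2) := by
    intro i
    have e : ∀ j, (if i = j then (1 : ℝ) else bloch l (φ i) * bloch l (φ j)) =
        bloch l (φ i) * bloch l (φ j) + (if i = j then 1 - bloch l (φ i) ^ 2 else 0) := by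
      intro j
      split_ifs with h
      · subst h; ring
      · ring
    simp_rw [e]
    rw [Finset.sum_add_distrib, Finset.sum_ite_eq, if_pos (Finset.mem_univ _), ← Finset.mul_sum]
    ring
  simp_rw [h]
  rw [Finset.sum_add_distrib, Finset.sum_sub_distrib, Finset.sum_const, Finset.card_univ,
    Fintype.card_fin, ← Finset.sum_mul, nsmul_eq_mul, mul_one]
  ring

/-- The variance `(ΔA)² = ⟨A²⟩ − ⟨A⟩²` of an observable in the vector state `ψ`.
[cite: GuhneToth2009, §8.1 (“`(ΔJ_k)² = ⟨J_k²⟩ − ⟨J_k⟩²`”)] -/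
def variance (ψ : (Fin N → Bool) → ℂ) (A : Matrix (Fin N → Bool) (Fin N → Bool) ℂ) : ℝ :=
  vecState ψ (A * A) - vecState ψ A ^ 2

/-- **“The variance of a collective observable is the sum of the single-particle variances”**:
`(ΔJ_l)² = ¼ Σ_i (1 − l_i²)` in a product state. [cite: GuhneToth2009, §8.1] -/
theorem variance_collectiveSpin (l : Pauli) :
    variance (productVec φ) (collectiveSpin l N) = 1 / 4 * ∑ i, (1 - bloch l (φ i) ^ 2) := by
  rw [variance, expect_collectiveSpin_sq φ hφ, expect_collectiveSpin φ hφ, Finset.sum_sub_distrib,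
    Finset.sum_const, Finset.card_univ, Fintype.card_fin, nsmul_eq_mul, mul_one]
  ring

end ProductState

/-! ## The single-qubit Bloch sphere: `x² + y² + z² = 1` -/

/-- For a unit qubit vector, `⟨σ_x⟩² + ⟨σ_y⟩² + ⟨σ_z⟩² = 1`. [cite: GuhneToth2009, §8.1.1] -/
theorem bloch_sq_sum (φ : Bool → ℂ) (hφ : star φ ⬝ᵥ φ = 1) :
    bloch Pauli.X φ ^ 2 + bloch Pauli.Y φ ^ 2 + bloch Pauli.Z φ ^ 2 = 1 := by
  have hunit : (φ false).re ^ 2 + (φ false).im ^ 2 + ((φ true).re ^ 2 + (φ true).im ^ 2) = 1 := by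
    have h := congrArg Complex.re hφ
    simp [dotProduct, Complex.mul_re, Complex.conj_re, Complex.conj_im] at h
    nlinarith [h]
  simp only [bloch, Matrix.mulVec, dotProduct, Fintype.sum_bool, Pi.star_apply, Pauli.mat_X_apply,
    Pauli.mat_Y_apply, Pauli.mat_Z_apply]
  simp [Complex.mul_re, Complex.mul_im, Complex.conj_re, Complex.conj_im]
  nlinarith [hunit]

/-! ## Eq. (194) for pure product states -/

/-- **Eq. (194) for pure product states**, multiplied out: `⟨J_x⟩² + ⟨J_y⟩² ≤ N·(ΔJ_z)²`
(from `(ΔJ_z)² = ¼Σ(x_i² + y_i²)` and Cauchy–Schwarz `(Σx_i)² ≤ NΣx_i²`).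
[cite: GuhneToth2009, §8.1.1 eq. (194)] -/
theorem spinSqueezing_productVec (φ : Fin N → Bool → ℂ) (hφ : ∀ i, star (φ i) ⬝ᵥ φ i = 1) :
    vecState (productVec φ) (collectiveSpin Pauli.X N) ^ 2 +
        vecState (productVec φ) (collectiveSpin Pauli.Y N) ^ 2 ≤
      N * variance (productVec φ) (collectiveSpin Pauli.Z N) := by
  rw [expect_collectiveSpin φ hφ, expect_collectiveSpin φ hφ, variance_collectiveSpin φ hφ]
  have hb : ∀ i, 1 - bloch Pauli.Z (φ i) ^ 2 = bloch Pauli.X (φ i) ^ 2 + bloch Pauli.Y (φ i) ^ 2 :=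
    fun i => by have := bloch_sq_sum (φ i) (hφ i); linarith
  simp_rw [hb]
  have hx := sq_sum_le_card_mul_sum_sq (s := Finset.univ) (f := fun i => bloch Pauli.X (φ i))
  have hy := sq_sum_le_card_mul_sum_sq (s := Finset.univ) (f := fun i => bloch Pauli.Y (φ i))
  rw [Finset.card_univ, Fintype.card_fin] at hx hy
  rw [Finset.sum_add_distrib]
  nlinarith [hx, hy]

/-! ## Fully separable (mixed) states and eq. (194) -/

/-- A pure product state `⊗_i φ_i` with unit factors. [cite: GuhneToth2009, §8.1.1 (“fully
separable”)] -/
def IsProductPure (ψ : (Fin N → Bool) → ℂ) : Prop :=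
  ∃ φ : Fin N → Bool → ℂ, (∀ i, star (φ i) ⬝ᵥ φ i = 1) ∧ ψ = productVec φ

/-- A *fully separable* `N`-qubit density matrix: a convex combination `Σ_k p_k |ψ_k⟩⟨ψ_k|` of
pure product states. [cite: GuhneToth2009, §8.1.1 (“entangled, i.e., not fully separable”)] -/
def IsSeparable (ρ : Matrix (Fin N → Bool) (Fin N → Bool) ℂ) : Prop :=
  ∃ (ι : Type) (_ : Fintype ι) (p : ι → ℝ) (ψ : ι → (Fin N → Bool) → ℂ),
    (∀ k, 0 ≤ p k) ∧ ∑ k, p k = 1 ∧ (∀ k, IsProductPure (ψ k)) ∧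
      ρ = ∑ k, (p k : ℂ) • vecMulVec (ψ k) (star (ψ k))

/-- The variance `(ΔA)²_ρ = Tr(ρA²) − Tr(ρA)²` in the state `ρ`. [cite: GuhneToth2009, §8.1] -/
def varianceT (ρ : Matrix (Fin N → Bool) (Fin N → Bool) ℂ)
    (A : Matrix (Fin N → Bool) (Fin N → Bool) ℂ) : ℝ :=
  trState ρ (A * A) - trState ρ A ^ 2

/-- `Tr(|ψ⟩⟨ψ| M) = ⟨ψ|M|ψ⟩`. [cite: GuhneToth2009, §8.1] -/
private theorem trState_vecMulVec (ψ : (Fin N → Bool) → ℂ)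
    (M : Matrix (Fin N → Bool) (Fin N → Bool) ℂ) :
    trState (vecMulVec ψ (star ψ)) M = vecState ψ M := by
  rw [trState_apply, vecState_apply, Matrix.trace_mul_comm, Matrix.mul_vecMulVec,
    Matrix.trace_vecMulVec, dotProduct_comm]

/-- `Tr((Σ p_k |ψ_k⟩⟨ψ_k|) M) = Σ p_k ⟨ψ_k|M|ψ_k⟩`. [cite: GuhneToth2009, §8.1] -/
private theorem trState_mixture {ι : Type*} [Fintype ι] (p : ι → ℝ)
    (ψ : ι → (Fin N → Bool) → ℂ) (M : Matrix (Fin N → Bool) (Fin N → Bool) ℂ) :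
    trState (∑ k, (p k : ℂ) • vecMulVec (ψ k) (star (ψ k))) M = ∑ k, p k * vecState (ψ k) M := by
  rw [trState_apply, Finset.sum_mul, Matrix.trace_sum, Complex.re_sum]
  refine Finset.sum_congr rfl fun k _ => ?_
  rw [Matrix.smul_mul, Matrix.trace_smul, smul_eq_mul, Complex.re_ofReal_mul, ← trState_apply,
    trState_vecMulVec]

/-- Jensen / Cauchy–Schwarz for a probability vector: `(Σ p_k a_k)² ≤ Σ p_k a_k²` (the convexity
of `⟨J⟩²` and concavity of the variance along mixtures). [cite: GuhneToth2009, §8.1.1] -/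
private theorem sq_sum_le_sum_mul_sq {ι : Type*} [Fintype ι] (p a : ι → ℝ) (hp : ∀ k, 0 ≤ p k)
    (h1 : ∑ k, p k = 1) : (∑ k, p k * a k) ^ 2 ≤ ∑ k, p k * a k ^ 2 := by
  set m := ∑ k, p k * a k with hm
  have h0 : 0 ≤ ∑ k, p k * (a k - m) ^ 2 :=
    Finset.sum_nonneg fun k _ => mul_nonneg (hp k) (sq_nonneg _)
  have he : ∑ k, p k * (a k - m) ^ 2 =
      ∑ k, (p k * a k ^ 2 - 2 * m * (p k * a k) + m ^ 2 * p k) :=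
    Finset.sum_congr rfl fun k _ => by ring
  rw [he, Finset.sum_add_distrib, Finset.sum_sub_distrib, ← Finset.mul_sum, ← Finset.mul_sum,
    ← hm, h1] at h0
  nlinarith [h0]

/-- **The spin-squeezing criterion, eq. (194), multiplied out**: for every fully separable
`N`-qubit state, `⟨J_x⟩² + ⟨J_y⟩² ≤ N·(ΔJ_z)²`.  Proof: the pure-product bound, concavity of the
variance and convexity of `⟨J_x⟩², ⟨J_y⟩²` along the mixture. [cite: GuhneToth2009, §8.1.1
eq. (194)] -/
theorem spinSqueezing_criterion {ρ : Matrix (Fin N → Bool) (Fin N → Bool) ℂ} (hρ : IsSeparable ρ) :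
    trState ρ (collectiveSpin Pauli.X N) ^ 2 + trState ρ (collectiveSpin Pauli.Y N) ^ 2 ≤
      N * varianceT ρ (collectiveSpin Pauli.Z N) := by
  obtain ⟨ι, _, p, ψ, hp, h1, hψ, rfl⟩ := hρ
  rw [varianceT, trState_mixture, trState_mixture, trState_mixture, trState_mixture]
  set ax := fun k => vecState (ψ k) (collectiveSpin Pauli.X N)
  set ay := fun k => vecState (ψ k) (collectiveSpin Pauli.Y N)
  set az := fun k => vecState (ψ k) (collectiveSpin Pauli.Z N)
  set vz := fun k => vecState (ψ k) (collectiveSpin Pauli.Z N * collectiveSpin Pauli.Z N)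
  have hpure : ∀ k, ax k ^ 2 + ay k ^ 2 ≤ N * (vz k - az k ^ 2) := by
    intro k
    obtain ⟨φ, hφ, hk⟩ := hψ k
    have h := spinSqueezing_productVec φ hφ
    simp only [ax, ay, az, vz, hk, variance] at h ⊢
    exact h
  have hsum : ∑ k, p k * (ax k ^ 2 + ay k ^ 2) ≤ ∑ k, p k * (N * (vz k - az k ^ 2)) :=
    Finset.sum_le_sum fun k _ => mul_le_mul_of_nonneg_left (hpure k) (hp k)
  have e1 : ∑ k, p k * (ax k ^ 2 + ay k ^ 2) = ∑ k, p k * ax k ^ 2 + ∑ k, p k * ay k ^ 2 := by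
    rw [← Finset.sum_add_distrib]; exact Finset.sum_congr rfl fun k _ => by ring
  have e2 : ∑ k, p k * (N * (vz k - az k ^ 2)) = N * (∑ k, p k * vz k - ∑ k, p k * az k ^ 2) := by
    rw [← Finset.sum_sub_distrib, Finset.mul_sum]; exact Finset.sum_congr rfl fun k _ => by ring
  have jx := sq_sum_le_sum_mul_sq p ax hp h1
  have jy := sq_sum_le_sum_mul_sq p ay hp h1
  have jz := sq_sum_le_sum_mul_sq p az hp h1
  have hN : (0 : ℝ) ≤ N := Nat.cast_nonneg N
  rw [e1, e2] at hsum
  nlinarith [hsum, jx, jy, jz, hN]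

/-- **Eq. (194) as printed**: for a fully separable state with `⟨J_x⟩² + ⟨J_y⟩² ≠ 0`,
`(ΔJ_z)²/(⟨J_x⟩² + ⟨J_y⟩²) ≥ 1/N` (`N ≥ 1`). [cite: GuhneToth2009, §8.1.1 eq. (194)] -/
theorem spinSqueezing_criterion_div [NeZero N] {ρ : Matrix (Fin N → Bool) (Fin N → Bool) ℂ}
    (hρ : IsSeparable ρ)
    (hden : trState ρ (collectiveSpin Pauli.X N) ^ 2 + trState ρ (collectiveSpin Pauli.Y N) ^ 2 ≠ 0) :
    1 / (N : ℝ) ≤ varianceT ρ (collectiveSpin Pauli.Z N) /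
      (trState ρ (collectiveSpin Pauli.X N) ^ 2 + trState ρ (collectiveSpin Pauli.Y N) ^ 2) := by
  have h := spinSqueezing_criterion hρ
  have hpos : 0 < trState ρ (collectiveSpin Pauli.X N) ^ 2 +
      trState ρ (collectiveSpin Pauli.Y N) ^ 2 :=
    lt_of_le_of_ne (by positivity) (Ne.symm hden)
  have hN : (0 : ℝ) < N := by exact_mod_cast Nat.pos_of_ne_zero (NeZero.ne N)
  rw [div_le_div_iff₀ hN hpos, one_mul, mul_comm]
  exact h

/-- **Violation of (194) certifies entanglement**: if `N·(ΔJ_z)² < ⟨J_x⟩² + ⟨J_y⟩²` then `ρ` is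
not fully separable. [cite: GuhneToth2009, §8.1.1 (“then the state is entangled, i.e., not
fully separable”)] -/
theorem not_isSeparable_of_squeezing {ρ : Matrix (Fin N → Bool) (Fin N → Bool) ℂ}
    (h : N * varianceT ρ (collectiveSpin Pauli.Z N) <
      trState ρ (collectiveSpin Pauli.X N) ^ 2 + trState ρ (collectiveSpin Pauli.Y N) ^ 2) :
    ¬ IsSeparable ρ :=
  fun hρ => absurd h (not_lt.2 (spinSqueezing_criterion hρ))

/-! ## Saturation by the fully polarized sample `|½⟩_x^{⊗N}` -/

/-- `|+⟩ = (|0⟩ + |1⟩)/√2`, the `x`-polarized qubit. [cite: GuhneToth2009, §8.1.1] -/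
def plusVec : Bool → ℂ := fun _ => (CHSHOpt.invSqrtTwo : ℂ)

/-- `⟨+|+⟩ = 1`. [cite: GuhneToth2009, §8.1.1] -/
theorem plusVec_unit : star plusVec ⬝ᵥ plusVec = 1 := by
  simp only [dotProduct, Fintype.sum_bool, Pi.star_apply, plusVec, Complex.star_def,
    Complex.conj_ofReal, ← Complex.ofReal_mul, CHSHOpt.invSqrtTwo_mul_self]
  push_cast; ring

/-- Bloch vector of `|+⟩`: `(1, 0, 0)`. [cite: GuhneToth2009, §8.1.1] -/
theorem bloch_plusVec :
    bloch Pauli.X plusVec = 1 ∧ bloch Pauli.Y plusVec = 0 ∧ bloch Pauli.Z plusVec = 0 := by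
  have h2 : CHSHOpt.invSqrtTwo * CHSHOpt.invSqrtTwo = 1 / 2 := CHSHOpt.invSqrtTwo_mul_self
  simp only [bloch, Matrix.mulVec, dotProduct, Fintype.sum_bool, Pi.star_apply, plusVec,
    Pauli.mat_X_apply, Pauli.mat_Y_apply, Pauli.mat_Z_apply, Complex.star_def, Complex.conj_ofReal]
  simp only [if_true, Bool.false_eq_true, Bool.true_eq_false, if_false]
  refine ⟨?_, ?_, ?_⟩
  · rw [show (CHSHOpt.invSqrtTwo : ℂ) * (0 * CHSHOpt.invSqrtTwo + 1 * CHSHOpt.invSqrtTwo) +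
        CHSHOpt.invSqrtTwo * (1 * CHSHOpt.invSqrtTwo + 0 * CHSHOpt.invSqrtTwo) =
        ((CHSHOpt.invSqrtTwo * CHSHOpt.invSqrtTwo + CHSHOpt.invSqrtTwo * CHSHOpt.invSqrtTwo : ℝ) : ℂ)
        by push_cast; ring, Complex.ofReal_re]
    linarith
  · rw [show (CHSHOpt.invSqrtTwo : ℂ) * (0 * CHSHOpt.invSqrtTwo + Complex.I * CHSHOpt.invSqrtTwo) +
        CHSHOpt.invSqrtTwo * (-Complex.I * CHSHOpt.invSqrtTwo + 0 * CHSHOpt.invSqrtTwo) = 0 by ring,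
      Complex.zero_re]
  · rw [show (CHSHOpt.invSqrtTwo : ℂ) * (-1 * CHSHOpt.invSqrtTwo + 0 * CHSHOpt.invSqrtTwo) +
        CHSHOpt.invSqrtTwo * (0 * CHSHOpt.invSqrtTwo + 1 * CHSHOpt.invSqrtTwo) = 0 by ring,
      Complex.zero_re]

/-- **“Such a state saturates Eq. (194)”**: for `|Ψ⟩_init = |+⟩^{⊗N}`: `⟨J_x⟩ = N/2`, `⟨J_y⟩ = 0`,
`(ΔJ_z)² = N/4`, so `⟨J_x⟩² + ⟨J_y⟩² = N·(ΔJ_z)²`. [cite: GuhneToth2009, §8.1.1] -/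
theorem saturation_polarized :
    vecState (productVec fun _ : Fin N => plusVec) (collectiveSpin Pauli.X N) = N / 2 ∧
      vecState (productVec fun _ : Fin N => plusVec) (collectiveSpin Pauli.Y N) = 0 ∧
      variance (productVec fun _ : Fin N => plusVec) (collectiveSpin Pauli.Z N) = N / 4 := by
  have hφ : ∀ _i : Fin N, star plusVec ⬝ᵥ plusVec = 1 := fun _ => plusVec_unit
  obtain ⟨hx, hy, hz⟩ := bloch_plusVec
  refine ⟨?_, ?_, ?_⟩
  · rw [expect_collectiveSpin (fun _ => plusVec) hφ]
    simp [hx]; ring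
  · rw [expect_collectiveSpin (fun _ => plusVec) hφ]
    simp [hy]
  · rw [variance_collectiveSpin (fun _ => plusVec) hφ]
    simp [hz]; ring

/-! ## The singlet criterion (195): `(ΔJ_x)² + (ΔJ_y)² + (ΔJ_z)² ≥ N/2` on separable states -/

/-- **“All pure product states saturate the inequality”** (195): in a product state
`(ΔJ_x)² + (ΔJ_y)² + (ΔJ_z)² = N/2` (each qubit contributes `¼(3 − (x² + y² + z²)) = ½`).
[cite: GuhneToth2009, §8.1.2 eq. (195)] -/
theorem sum_variance_productVec (φ : Fin N → Bool → ℂ) (hφ : ∀ i, star (φ i) ⬝ᵥ φ i = 1) :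
    variance (productVec φ) (collectiveSpin Pauli.X N) +
        variance (productVec φ) (collectiveSpin Pauli.Y N) +
        variance (productVec φ) (collectiveSpin Pauli.Z N) = N / 2 := by
  rw [variance_collectiveSpin φ hφ, variance_collectiveSpin φ hφ, variance_collectiveSpin φ hφ]
  have h : ∀ i, (1 - bloch Pauli.X (φ i) ^ 2) + (1 - bloch Pauli.Y (φ i) ^ 2) +
      (1 - bloch Pauli.Z (φ i) ^ 2) = 2 := fun i => by
    have := bloch_sq_sum (φ i) (hφ i); linarith
  have hs : ∑ i, (1 - bloch Pauli.X (φ i) ^ 2) + ∑ i, (1 - bloch Pauli.Y (φ i) ^ 2) +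
      ∑ i, (1 - bloch Pauli.Z (φ i) ^ 2) = 2 * (N : ℝ) := by
    rw [← Finset.sum_add_distrib, ← Finset.sum_add_distrib]
    simp_rw [h]
    rw [Finset.sum_const, Finset.card_univ, Fintype.card_fin, nsmul_eq_mul, mul_comm]
  linarith

/-- **Concavity of the variance** along a mixture: `(ΔA)²_ρ ≥ Σ_k p_k (ΔA)²_{ψ_k}` for
`ρ = Σ_k p_k |ψ_k⟩⟨ψ_k|`. [cite: GuhneToth2009, §8.1.2] -/
theorem varianceT_mixture_ge {ι : Type*} [Fintype ι] (p : ι → ℝ) (hp : ∀ k, 0 ≤ p k)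
    (h1 : ∑ k, p k = 1) (ψ : ι → (Fin N → Bool) → ℂ) (A : Matrix (Fin N → Bool) (Fin N → Bool) ℂ) :
    ∑ k, p k * variance (ψ k) A ≤
      varianceT (∑ k, (p k : ℂ) • vecMulVec (ψ k) (star (ψ k))) A := by
  rw [varianceT, trState_mixture, trState_mixture]
  have j := sq_sum_le_sum_mul_sq p (fun k => vecState (ψ k) A) hp h1
  have e : ∑ k, p k * variance (ψ k) A =
      ∑ k, p k * vecState (ψ k) (A * A) - ∑ k, p k * vecState (ψ k) A ^ 2 := by
    rw [← Finset.sum_sub_distrib]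
    exact Finset.sum_congr rfl fun k _ => by rw [variance]; ring
  rw [e]
  linarith

/-- **The singlet criterion, eq. (195)**: for every fully separable `N`-qubit state,
`(ΔJ_x)² + (ΔJ_y)² + (ΔJ_z)² ≥ N/2`. [cite: GuhneToth2009, §8.1.2 eq. (195)] -/
theorem singlet_criterion {ρ : Matrix (Fin N → Bool) (Fin N → Bool) ℂ} (hρ : IsSeparable ρ) :
    (N : ℝ) / 2 ≤ varianceT ρ (collectiveSpin Pauli.X N) + varianceT ρ (collectiveSpin Pauli.Y N) +
      varianceT ρ (collectiveSpin Pauli.Z N) := by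
  obtain ⟨ι, _, p, ψ, hp, h1, hψ, rfl⟩ := hρ
  have hx := varianceT_mixture_ge p hp h1 ψ (collectiveSpin Pauli.X N)
  have hy := varianceT_mixture_ge p hp h1 ψ (collectiveSpin Pauli.Y N)
  have hz := varianceT_mixture_ge p hp h1 ψ (collectiveSpin Pauli.Z N)
  have hsum : ∑ k, p k * variance (ψ k) (collectiveSpin Pauli.X N) +
      ∑ k, p k * variance (ψ k) (collectiveSpin Pauli.Y N) +
      ∑ k, p k * variance (ψ k) (collectiveSpin Pauli.Z N) = N / 2 := by
    rw [← Finset.sum_add_distrib, ← Finset.sum_add_distrib]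
    have hk : ∀ k, p k * variance (ψ k) (collectiveSpin Pauli.X N) +
        p k * variance (ψ k) (collectiveSpin Pauli.Y N) +
        p k * variance (ψ k) (collectiveSpin Pauli.Z N) = p k * (N / 2) := by
      intro k
      obtain ⟨φ, hφ, hk⟩ := hψ k
      rw [hk, ← mul_add, ← mul_add, sum_variance_productVec φ hφ]
    simp_rw [hk]
    rw [← Finset.sum_mul, h1, one_mul]
  linarith

/-- Violation of (195) certifies entanglement. [cite: GuhneToth2009, §8.1.2 eq. (195)] -/
theorem not_isSeparable_of_singlet_violation {ρ : Matrix (Fin N → Bool) (Fin N → Bool) ℂ}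
    (h : varianceT ρ (collectiveSpin Pauli.X N) + varianceT ρ (collectiveSpin Pauli.Y N) +
      varianceT ρ (collectiveSpin Pauli.Z N) < (N : ℝ) / 2) : ¬ IsSeparable ρ :=
  fun hρ => absurd h (not_lt.2 (singlet_criterion hρ))

/-! ## The Dicke-state criterion (197): `⟨J_x²⟩ + ⟨J_y²⟩ ≤ (N/2)(N/2 + ½)` on separable states -/

/-- Planar cross terms: for vectors `(x_i, y_i)` in the unit disc,
`(Σx_i)² + (Σy_i)² − Σ(x_i² + y_i²) = Σ_{i≠j}(x_ix_j + y_iy_j) ≤ N(N − 1)`.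
[cite: GuhneToth2009, §8.1.3 eq. (197)] -/
private theorem cross_terms_le (x y : Fin N → ℝ) (h : ∀ i, x i ^ 2 + y i ^ 2 ≤ 1) :
    (∑ i, x i) ^ 2 + (∑ i, y i) ^ 2 - ∑ i, (x i ^ 2 + y i ^ 2) ≤ N * (N - 1) := by
  set X := ∑ i, x i
  set Y := ∑ i, y i
  -- `X² + Y² − Σ(x² + y²) = Σ_i (x_i (X − x_i) + y_i (Y − y_i))`
  have he : X ^ 2 + Y ^ 2 - ∑ i, (x i ^ 2 + y i ^ 2) =
      ∑ i, (x i * (X - x i) + y i * (Y - y i)) := by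
    have e1 : ∑ i, (x i * (X - x i) + y i * (Y - y i)) =
        X * ∑ i, x i + Y * ∑ i, y i - ∑ i, (x i ^ 2 + y i ^ 2) := by
      rw [Finset.mul_sum, Finset.mul_sum, ← Finset.sum_add_distrib, ← Finset.sum_sub_distrib]
      exact Finset.sum_congr rfl fun i _ => by ring
    rw [e1]; ring
  rw [he]
  -- each term is at most `N − 1`
  have hterm : ∀ i, x i * (X - x i) + y i * (Y - y i) ≤ (N : ℝ) - 1 := by
    intro i
    have hX : X - x i = ∑ j ∈ Finset.univ.erase i, x j := by
      rw [Finset.sum_erase_eq_sub (Finset.mem_univ i)]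
    have hY : Y - y i = ∑ j ∈ Finset.univ.erase i, y j := by
      rw [Finset.sum_erase_eq_sub (Finset.mem_univ i)]
    have hcard : ((Finset.univ.erase i).card : ℝ) = N - 1 := by
      rw [Finset.card_erase_of_mem (Finset.mem_univ i), Finset.card_univ, Fintype.card_fin,
        Nat.cast_sub (Nat.pos_of_ne_zero (fun h0 => by subst h0; exact i.elim0)), Nat.cast_one]
    have hN1 : (0 : ℝ) ≤ N - 1 := by rw [← hcard]; exact Nat.cast_nonneg _
    -- `(X − x_i)² + (Y − y_i)² ≤ (N−1)·Σ_{j≠i}(x_j² + y_j²) ≤ (N−1)²`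
    have hbx := sq_sum_le_card_mul_sum_sq (s := Finset.univ.erase i) (f := x)
    have hby := sq_sum_le_card_mul_sum_sq (s := Finset.univ.erase i) (f := y)
    rw [← hX, hcard] at hbx
    rw [← hY, hcard] at hby
    have hsum1 : ∑ j ∈ Finset.univ.erase i, (x j ^ 2 + y j ^ 2) ≤ N - 1 := by
      calc ∑ j ∈ Finset.univ.erase i, (x j ^ 2 + y j ^ 2) ≤ ∑ j ∈ Finset.univ.erase i, (1 : ℝ) :=
            Finset.sum_le_sum fun j _ => h j
        _ = N - 1 := by rw [Finset.sum_const, nsmul_eq_mul, mul_one, hcard]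
    have hb : (X - x i) ^ 2 + (Y - y i) ^ 2 ≤ (N - 1) ^ 2 := by
      have : (X - x i) ^ 2 + (Y - y i) ^ 2 ≤
          (N - 1) * ∑ j ∈ Finset.univ.erase i, (x j ^ 2 + y j ^ 2) := by
        rw [Finset.sum_add_distrib, mul_add]; exact add_le_add hbx hby
      nlinarith [this, hsum1, hN1]
    -- Cauchy–Schwarz in the plane: `(a·b)² ≤ |a|²|b|² ≤ 1·(N−1)²`
    have hcs : (x i * (X - x i) + y i * (Y - y i)) ^ 2 ≤
        (x i ^ 2 + y i ^ 2) * ((X - x i) ^ 2 + (Y - y i) ^ 2) := by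
      nlinarith [sq_nonneg (x i * (Y - y i) - y i * (X - x i))]
    have hsq : (x i * (X - x i) + y i * (Y - y i)) ^ 2 ≤ ((N : ℝ) - 1) ^ 2 := by
      refine hcs.trans ?_
      calc (x i ^ 2 + y i ^ 2) * ((X - x i) ^ 2 + (Y - y i) ^ 2)
          ≤ 1 * ((X - x i) ^ 2 + (Y - y i) ^ 2) :=
            mul_le_mul_of_nonneg_right (h i) (by positivity)
        _ ≤ (N - 1) ^ 2 := by rw [one_mul]; exact hb
    exact (le_abs_self _).trans (abs_le_of_sq_le_sq hsq hN1)
  calc ∑ i, (x i * (X - x i) + y i * (Y - y i)) ≤ ∑ _i : Fin N, ((N : ℝ) - 1) :=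
        Finset.sum_le_sum fun i _ => hterm i
    _ = N * (N - 1) := by rw [Finset.sum_const, Finset.card_univ, Fintype.card_fin, nsmul_eq_mul]

/-- **Eq. (197) for pure product states**: `⟨J_x²⟩ + ⟨J_y²⟩ ≤ (N/2)(N/2 + ½)`.
[cite: GuhneToth2009, §8.1.3 eq. (197)] -/
theorem dicke_criterion_productVec (φ : Fin N → Bool → ℂ) (hφ : ∀ i, star (φ i) ⬝ᵥ φ i = 1) :
    vecState (productVec φ) (collectiveSpin Pauli.X N * collectiveSpin Pauli.X N) +
        vecState (productVec φ) (collectiveSpin Pauli.Y N * collectiveSpin Pauli.Y N) ≤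
      (N : ℝ) / 2 * (N / 2 + 1 / 2) := by
  rw [expect_collectiveSpin_sq φ hφ, expect_collectiveSpin_sq φ hφ]
  have hb : ∀ i, bloch Pauli.X (φ i) ^ 2 + bloch Pauli.Y (φ i) ^ 2 ≤ 1 := fun i => by
    have := bloch_sq_sum (φ i) (hφ i); nlinarith [sq_nonneg (bloch Pauli.Z (φ i))]
  have hc := cross_terms_le (fun i => bloch Pauli.X (φ i)) (fun i => bloch Pauli.Y (φ i)) hb
  rw [Finset.sum_add_distrib] at hc
  nlinarith [hc]

/-- **The Dicke-state criterion, eq. (197)**: for every fully separable `N`-qubit state,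
`⟨J_x²⟩ + ⟨J_y²⟩ ≤ (N/2)(N/2 + ½)` (the functional is linear in `ϱ`, so the product-state bound
extends to mixtures). [cite: GuhneToth2009, §8.1.3 eq. (197)] -/
theorem dicke_criterion {ρ : Matrix (Fin N → Bool) (Fin N → Bool) ℂ} (hρ : IsSeparable ρ) :
    trState ρ (collectiveSpin Pauli.X N * collectiveSpin Pauli.X N) +
        trState ρ (collectiveSpin Pauli.Y N * collectiveSpin Pauli.Y N) ≤
      (N : ℝ) / 2 * (N / 2 + 1 / 2) := by
  obtain ⟨ι, _, p, ψ, hp, h1, hψ, rfl⟩ := hρ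
  rw [trState_mixture, trState_mixture, ← Finset.sum_add_distrib]
  have hk : ∀ k, p k * vecState (ψ k) (collectiveSpin Pauli.X N * collectiveSpin Pauli.X N) +
      p k * vecState (ψ k) (collectiveSpin Pauli.Y N * collectiveSpin Pauli.Y N) ≤
      p k * ((N : ℝ) / 2 * (N / 2 + 1 / 2)) := by
    intro k
    obtain ⟨φ, hφ, hk⟩ := hψ k
    rw [← mul_add, hk]
    exact mul_le_mul_of_nonneg_left (dicke_criterion_productVec φ hφ) (hp k)
  calc _ ≤ ∑ k, p k * ((N : ℝ) / 2 * (N / 2 + 1 / 2)) := Finset.sum_le_sum fun k _ => hk k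
    _ = (N : ℝ) / 2 * (N / 2 + 1 / 2) := by rw [← Finset.sum_mul, h1, one_mul]

/-- Violation of (197) certifies entanglement (“detects entanglement close to the `N`-qubit Dicke
state with two [sic: `N/2`] excitations”). [cite: GuhneToth2009, §8.1.3 eq. (197)] -/
theorem not_isSeparable_of_dicke_violation {ρ : Matrix (Fin N → Bool) (Fin N → Bool) ℂ}
    (h : (N : ℝ) / 2 * (N / 2 + 1 / 2) <
      trState ρ (collectiveSpin Pauli.X N * collectiveSpin Pauli.X N) +
        trState ρ (collectiveSpin Pauli.Y N * collectiveSpin Pauli.Y N)) : ¬ IsSeparable ρ :=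
  fun hρ => absurd h (not_lt.2 (dicke_criterion hρ))

/-! ## Fully separable ⟹ biseparable (link to `GHZFidelityWitness.lean`) -/

/-- A product vector is a tensor product across every cut `A`:
`⊗_i φ_i = (⊗_{i∈A} φ_i) ⊗ (⊗_{i∉A} φ_i)`. [cite: GuhneToth2009, §8.1.1 (“fully separable”)
with §3.3 (biseparability with respect to a cut)] -/
theorem productVec_eq_tensorAcross (A : Finset (Fin N)) (φ : Fin N → Bool → ℂ) :
    productVec φ = GHZWitness.tensorAcross A (fun xa => ∏ i : {i // i ∈ A}, φ i (xa i))
      (fun xb => ∏ i : {i // i ∉ A}, φ i (xb i)) := by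
  funext x
  rw [productVec_apply, GHZWitness.tensorAcross_apply]
  simp only [GHZWitness.restrictIn, GHZWitness.restrictOut]
  rw [← Finset.prod_subtype A (fun _ => Iff.rfl) (fun i => φ i (x i)),
    ← Finset.prod_subtype Aᶜ (fun i => Finset.mem_compl) (fun i => φ i (x i)),
    Finset.prod_mul_prod_compl]

/-- A pure product state of `N ≥ 2` qubits is biseparable (across the cut `{0} | rest`).
[cite: GuhneToth2009, §3.3 (fully separable states are biseparable)] -/
theorem IsProductPure.isBiseparablePure (h2 : 2 ≤ N) {ψ : (Fin N → Bool) → ℂ}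
    (h : IsProductPure ψ) : GHZWitness.IsBiseparablePure ψ := by
  obtain ⟨φ, -, rfl⟩ := h
  refine ⟨{(⟨0, by omega⟩ : Fin N)}, Finset.singleton_nonempty _, ?_, _, _,
    productVec_eq_tensorAcross _ φ⟩
  refine ⟨⟨1, by omega⟩, ?_⟩
  rw [Finset.mem_compl, Finset.mem_singleton]
  exact fun h => by simpa using congrArg Fin.val h

/-- **Fully separable ⟹ biseparable** (`N ≥ 2`): the `IsSeparable` states of this file are
`IsBiseparable` in the sense of `GHZFidelityWitness.lean`, so every genuine-multipartite-
entanglement criterion there also excludes full separability. [cite: GuhneToth2009, §3.3] -/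
theorem IsSeparable.isBiseparable (h2 : 2 ≤ N) {ρ : Matrix (Fin N → Bool) (Fin N → Bool) ℂ}
    (h : IsSeparable ρ) : GHZWitness.IsBiseparable ρ := by
  obtain ⟨ι, hι, p, ψ, hp, h1, hψ, rfl⟩ := h
  refine ⟨ι, hι, p, ψ, hp, h1, fun k => ?_, fun k => (hψ k).isBiseparablePure h2, rfl⟩
  obtain ⟨φ, hφ, hk⟩ := hψ k
  rw [hk, star_productVec_dotProduct]
  simp [hφ]

end SpinSqueezing

end Literature.InformationTheory.Entanglement
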